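import Summits.HodgeConjecture.HodgeConjecture.Theorems.HeckePrymWeilHyperbolicEightfoldsSqrtMinus7OfAnchorObjectBSEngine
import Summits.HodgeConjecture.HodgeConjecture.Theorems.HeckePrymWeilHyperbolicEightfoldsSqrtMinus7Spread
import Summits.HodgeConjecture.HodgeConjecture.Theorems.HeckePrymWeilHyperbolicEightfoldsSqrtMinus7GysinDescent
import HarnessLib

/-!
# Weil classes on HYPERBOLIC `K`-Weil abelian `2n`-folds from ONE anchor object on a BRAUER–SEVERI FAMILY
# (crux `HeckePrymWeil.HyperbolicEightfoldsSqrtMinus7`, item stmt-HodgeConjecture-14642, route HeckePrymWeil)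

Line `euler-squeeze-rank-two-secant-bundle`, skeleton v4 (lead c12, 2026-08-17): the composition, kernel-checked and landed as
a CONDITIONAL theorem; the engine step and the mechanism are documented in `…OfAnchorObjectBSEngine` (Markman, arXiv:2502.03415,
Lemma 7.5.1 and §7.5.2 Steps 1–5: the untwisted semiregular model of the twisted secant square lives on the Brauer–Severi
variety, and Buchweitz–Flenner/Perry is applied there).  Nothing is asserted: the six hypotheses of
`weilClasses_algebraic_of_anchorObjectBS` are the six other registered stubs of the skeleton — the anchor object on the
Brauer–Severi family (`hO`, the bet; at `(4, 7)` verbatim `stub_anchorObjectBS`), `weilFamilyReach_hyperbolic` (F),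
`Perry2026_semiregularFull_remainsAlgebraic` (P), `Nonempty StandardChernCharacterBetti` (C), spread of algebraicity from a
Zariski-open set of fibres (`hK` = `stub_spread`, tree-provable) and Gysin descent along projective-bundle fibres (`hD` =
`stub_gysinDescent`, tree-provable).  MECHANISM: F gives Deligne's family through the hyperbolic anchor with `H`, the Weil
section (globalised to `W` by the landed W-engine, rational along the section) and reach; `hO` applied to it gives the
Brauer–Severi family `π : 𝒬 → U` over `g : U → S`; `engine_of_perry_BS` makes the charged class algebraic on every `𝒬_u`; `hD`
(on the abelian fibre `H` is a divisor class: Lefschetz `(1,1)` + Kleiman, transported along `𝒳_{g(u)} ≅ A''`) gives `W|_{𝒳_{g(u)}}`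
algebraic; `hK` spreads it to every fibre, in particular the reached `𝒳_{s₁} ≅ A'`; one class suffices (unconditional) and
isogeny transfer (landed) return to `A`; at `(4, 7)` `stub_upgrade` types the plane and the crux follows BY NAME
(`hyperbolicEightfoldsSqrtMinus7_of_anchorObjectBS` = the registered `stub_composition` up to unfolding).
-/

noncomputable section

-- single-problem summit (Problem = Summit): the mandated namespace repeats `HodgeConjecture`.
set_option linter.dupNamespace false

open CategoryTheory AlgebraicGeometry Limits MonoidalCategory CartesianMonoidalCategory
open Literature.AlgebraicGeometry Literature.AlgebraicGeometry.Motives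
  Literature.AlgebraicGeometry.HodgeTheory
open Literature.AlgebraicTopology.SingularHomology
open Literature.NumberTheory.Transcendental (exists_deRhamIsoFamily_holds)
open Summit.HodgeConjecture.HodgeConjecture.Theorems.HeckePrymWeilLine
  (stub_upgrade stub_rationalAlongSection stub_isogenyTransfer owf_isoTransport)
open Summit.HodgeConjecture.HodgeConjecture.Theorems.HyperbolicEightfoldsSqrtMinus7.TensorAnchor
  (stub_globalClassEngine)
open Summit.HodgeConjecture.HodgeConjecture.Theorems.HyperbolicEightfoldsSqrtMinus7.AnchorObject
  (complexBetti_map_cupPowTwo cupPowTwo_mem_algebraicClasses_abelian)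

namespace Summit.HodgeConjecture.HodgeConjecture.Theorems.HyperbolicEightfoldsSqrtMinus7.AnchorObjectBS

/-! ## The strong Weil plane of every hyperbolic `K`-Weil `2n`-fold, from ONE anchor object on a Brauer–Severi family -/

/-- **Weil classes on EVERY hyperbolic `√-d`-Weil abelian `2n`-fold are algebraic, given ONE anchor object on a
Brauer–Severi family (`hO`), Deligne's hyperbolic family with reach (F), Perry's theorem (P), a standard Chern character
(C), spread (`hK`) and Gysin descent (`hD`)** — the line's v4 composition, every `n, d ≥ 1`; nothing is asserted.
[cite: Markman2025SecantWeil, Lemma 7.5.1 and §7.5.2 Steps 1–5] [cite: Deligne1982HodgeCycles, proof of Thm. 4.8]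
[cite: Perry2026Semiregularity, Thm. 1.1 (2)] [cite: vanGeemen1994HodgeAV, proof of Thm. 6.12] -/
theorem weilClasses_algebraic_of_anchorObjectBS (n d : ℕ) (hn : 1 ≤ n) (hd : 1 ≤ d)
    (hO : ∃ (P : AbelianVariety ℂ) (ψ : P ⟶ P) (e : ProjectiveEmbedding P.X)
      (a : complexBetti (projectiveSpace e.n ℂ) 2) (w : complexBetti P.X (2 * n)),
      P.dim = 2 * n ∧ ψ ≫ ψ = -(d • 𝟙 P) ∧ IsRationalClass a ∧ a ≠ 0 ∧
      IsHyperbolicWeilType P ψ n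
        ((d : ℂ) • complexBetti.map e.ι 2 a + complexBetti.map ψ.hom.hom.hom 2 (complexBetti.map e.ι 2 a)) ∧
      w ∈ weilClassesOf P ψ n d ∧ IsRationalClass w ∧ w ≠ 0 ∧
      ∀ (𝒳 S : SchemeOver ℂ) (f : 𝒳 ⟶ S) (s₀ : ComplexPoints S) (e' : P.X ≅ fiberOver f s₀),
        IsSmoothProjectiveFamily f (2 * n) →
        (∃ (N : ℕ) (ι : 𝒳 ⟶ MonoidalCategoryStruct.tensorObj (projectiveSpace N ℂ) S),
          IsClosedImmersion ι.left ∧ ι ≫ CartesianMonoidalCategory.snd (projectiveSpace N ℂ) S = f) →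
        IrreducibleSpace S.left → AlgebraicGeometry.Smooth S.hom → IsQuasiProjectiveOver S →
        (∀ s : ComplexPoints S, ∃ (A'' : AbelianVariety ℂ) (φ'' : A'' ⟶ A''),
          A''.dim = 2 * n ∧ φ'' ≫ φ'' = -(d • 𝟙 A'') ∧ Nonempty (A''.X ≅ fiberOver f s)) →
        ∃ (U 𝒬 : SchemeOver ℂ) (g : U ⟶ S) (π : 𝒬 ⟶ U) (p : 𝒬 ⟶ 𝒳) (m : ℕ) (u₀ : ComplexPoints U)
          (p₀ : fiberOver π u₀ ⟶ fiberOver f s₀) (Λ : complexBetti 𝒬 2) (V : Set S.left),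
          AlgebraicGeometry.Smooth U.hom ∧ IrreducibleSpace U.left ∧ IsQuasiProjectiveOver U ∧
          IsSmoothProjectiveFamily π (2 * n + m) ∧ p ≫ f = π ≫ g ∧ u₀ ≫ g = s₀ ∧
          p₀ ≫ fiberι f s₀ = fiberι π u₀ ≫ p ∧
          IsOpen V ∧ V.Nonempty ∧ (∀ t : ComplexPoints S, t.pt ∈ V → ∃ u : ComplexPoints U, u ≫ g = t) ∧
          (∀ u : ComplexPoints U,
            IsRationalClass (complexBetti.map (fiberι π u) 2 Λ) ∧
            IsOfHodgeType (2 * n + m) (fiberOver π u) 2 1 1 (complexBetti.map (fiberι π u) 2 Λ) ∧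
            (∀ j : ℕ, cupPowTwo (complexBetti.map (fiberι π u) 2 Λ) j ∈ algebraicClasses (fiberOver π u) j) ∧
            ∃ pu : fiberOver π u ⟶ fiberOver f (u ≫ g),
              pu ≫ fiberι f (u ≫ g) = fiberι π u ≫ p ∧ Function.Surjective pu.left.base ∧
              ∃ y : complexBetti (fiberOver f (u ≫ g)) (2 * (2 * n)),
                cupProduct (show 2 * (2 * n) + 2 * m = 2 * (2 * n + m) by omega)
                  (complexBetti.map pu (2 * (2 * n)) y) (cupPowTwo (complexBetti.map (fiberι π u) 2 Λ) m) ≠ 0) ∧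
          ∀ C : StandardChernCharacterBetti,
            ∃ (E₀ : (fiberOver π u₀).left.Modules) (hE₀ : IsFiniteLocallyFree E₀) (c : ℕ → ℕ → ℕ → ℚ) (r : ℕ → ℚ),
              r m ≠ 0 ∧ IsISemiregular hE₀ Set.univ ∧
              ∀ k : ℕ, C.ch (fiberOver π u₀) E₀ k =
                (∑ i ∈ Finset.range (k + 1), ∑ j ∈ Finset.range (k + 1),
                  if hij : i + j = k then
                    ((c k i j : ℚ) : ℂ) • cupProduct (show 2 * i + 2 * j = 2 * k by omega)
                      (complexBetti.map p₀ (2 * i) (complexBetti.map e'.inv (2 * i) (cupPowTwo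
                        ((d : ℂ) • complexBetti.map e.ι 2 a + complexBetti.map ψ.hom.hom.hom 2 (complexBetti.map e.ι 2 a)) i)))
                      (cupPowTwo (complexBetti.map (fiberι π u₀) 2 Λ) j)
                  else 0) +
                (if hk : n ≤ k then
                    ((r (k - n) : ℚ) : ℂ) • cupProduct (show 2 * n + 2 * (k - n) = 2 * k by omega)
                      (complexBetti.map p₀ (2 * n) (complexBetti.map e'.inv (2 * n) w))
                      (cupPowTwo (complexBetti.map (fiberι π u₀) 2 Λ) (k - n))
                  else 0))
    (hF : weilFamilyReach_hyperbolic) (hP : Perry2026_semiregularFull_remainsAlgebraic)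
    (hC : Nonempty StandardChernCharacterBetti)
    (hK : ∀ ⦃𝒳 S : SchemeOver ℂ⦄ (f : 𝒳 ⟶ S) (N p : ℕ), IsSmoothProjectiveFamily f N →
      (∃ (M : ℕ) (ι : 𝒳 ⟶ MonoidalCategoryStruct.tensorObj (projectiveSpace M ℂ) S),
        IsClosedImmersion ι.left ∧ ι ≫ CartesianMonoidalCategory.snd (projectiveSpace M ℂ) S = f) →
      IrreducibleSpace S.left → AlgebraicGeometry.Smooth S.hom → IsQuasiProjectiveOver S →
      ∀ (A : complexBetti 𝒳 (2 * p)) (V : Set S.left), IsOpen V → V.Nonempty →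
        (∀ t : ComplexPoints S, t.pt ∈ V →
          complexBetti.map (fiberι f t) (2 * p) A ∈ algebraicClasses (fiberOver f t) p) →
        ∀ t : ComplexPoints S, complexBetti.map (fiberι f t) (2 * p) A ∈ algebraicClasses (fiberOver f t) p)
    (hD : ∀ ⦃Q Y : SchemeOver ℂ⦄ (nY m : ℕ) (_hQ : IsSmoothProjective (nY + m) Q) (_hY : IsSmoothProjective nY Y)
      (p : Q ⟶ Y), Function.Surjective p.left.base →
      ∀ (H : complexBetti Y 2) (Λ : complexBetti Q 2),
        (∀ (l : ℕ) (α : complexBetti Y (2 * l)), α ∈ algebraicClasses Y l →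
          cupProduct (two_mul_add_two l) α H ∈ algebraicClasses Y (l + 1)) →
        (∀ i : ℕ, cupPowTwo H i ∈ algebraicClasses Y i) →
        (∀ j : ℕ, cupPowTwo Λ j ∈ algebraicClasses Q j) →
        (∃ y : complexBetti Y (2 * nY),
          cupProduct (show 2 * nY + 2 * m = 2 * (nY + m) by omega) (complexBetti.map p (2 * nY) y) (cupPowTwo Λ m) ≠ 0) →
        ∀ (n : ℕ) (W : complexBetti Y (2 * n)) (c : ℕ → ℕ → ℂ) (r : ℂ), r ≠ 0 →
          (∑ i ∈ Finset.range (n + m + 1), ∑ j ∈ Finset.range (n + m + 1),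
              if hij : i + j = n + m then
                c i j • cupProduct (show 2 * i + 2 * j = 2 * (n + m) by omega)
                  (complexBetti.map p (2 * i) (cupPowTwo H i)) (cupPowTwo Λ j)
              else 0) +
            r • cupProduct (show 2 * n + 2 * m = 2 * (n + m) by omega) (complexBetti.map p (2 * n) W) (cupPowTwo Λ m)
              ∈ algebraicClasses Q (n + m) →
          W ∈ algebraicClasses Y n)
    (A : AbelianVariety ℂ) (φ : A ⟶ A) (hA : A.dim = 2 * n) (hφ : φ ≫ φ = -(d • 𝟙 A))
    (eA : ProjectiveEmbedding A.X) (aA : complexBetti (projectiveSpace eA.n ℂ) 2) (haA : IsRationalClass aA)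
    (haA0 : aA ≠ 0)
    (hhypA : IsHyperbolicWeilType A φ n
      ((d : ℂ) • complexBetti.map eA.ι 2 aA + complexBetti.map φ.hom.hom.hom 2 (complexBetti.map eA.ι 2 aA))) :
    weilClassesOf A φ n d ≤ algebraicClasses A.X n := by
  -- the anchor object
  obtain ⟨P, ψ, e, a, w, hP8, hψ, ha, ha0, hhyp, hwW, hwrat, hw0, hobj⟩ := hO
  set h : complexBetti P.X 2 :=
    (d : ℂ) • complexBetti.map e.ι 2 a + complexBetti.map ψ.hom.hom.hom 2 (complexBetti.map e.ι 2 a) with hhdef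
  -- Deligne's family through the hyperbolic anchor `P`, section through `w`, reaching `A`
  obtain ⟨𝒳, S, f, s₀, s₁, e', A', φ', e₁, σ, H, hfam, hemb, hirr, hsm, hSqp, habS, hHfib, hHs₀, hσc, hpt, hσH,
      hσ₀, hA'dim, hφ'A, ⟨u, v, m', hm', huv, hu, hv⟩, w₁, hσ₁, hw₁W, hw₁0⟩ :=
    hF n d hn hd P ψ e a hP8 hψ ha ha0 hhyp w hwW hw0 A φ eA aA hA hφ haA haA0 hhypA
  -- the W-engine: `σ` is the restriction of a global class `W`
  obtain ⟨W, hWσ⟩ := stub_globalClassEngine f (2 * n) (2 * n) hfam hemb hsm hSqp hirr σ hσc hpt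
  have hcls : ∀ (s : ComplexPoints S) (y : complexBetti (fiberOver f s) (2 * n)),
      σ s = ⟨s, y⟩ → complexBetti.map (fiberι f s) (2 * n) W = y := by
    intro s y hy
    have h := (hWσ s).symm.trans hy
    simp only [globalSection, FiberClass.mk.injEq, heq_eq_eq, true_and] at h
    exact h
  have hW₀ : complexBetti.map (fiberι f s₀) (2 * n) W = complexBetti.map e'.inv (2 * n) w := hcls s₀ _ hσ₀
  have hW₁ : complexBetti.map (fiberι f s₁) (2 * n) W = w₁ := hcls s₁ _ hσ₁
  -- rationality along the section (landed), Hodge type along the section (the fact)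
  have hrat₀ : IsRationalClass (σ s₀).cls := by rw [hσ₀]; exact hwrat.map _
  have hratσ : ∀ s, IsRationalClass (σ s).cls :=
    stub_rationalAlongSection f (2 * n) (2 * n) hfam hsm hSqp hirr σ hσc hpt s₀ hrat₀
  have hWrat : ∀ s, IsRationalClass (complexBetti.map (fiberι f s) (2 * n) W) := by
    intro s
    have h := hratσ s
    rw [hWσ s] at h
    exact h
  have hWH : ∀ s, IsOfHodgeType (2 * n) (fiberOver f s) (2 * n) n n (complexBetti.map (fiberι f s) (2 * n) W) := by
    intro s
    have h := hσH s
    rw [hWσ s] at h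
    exact h
  -- `H_{s₀} = e'^{-1*} h(e, a)`
  rw [← hhdef] at hHs₀
  have hH₀ : complexBetti.map (fiberι f s₀) 2 H = complexBetti.map e'.inv 2 h := by
    rw [← hHs₀, e'.complexBetti_map_inv_map_hom]
  -- the anchor object ON THE BRAUER–SEVERI FAMILY over an étale-type neighbourhood of `s₀`
  obtain ⟨U, 𝒬, g, π, pp, m, u₀, p₀, Λ, V, hUsm, hUirr, hUqp, hπfam, hcomm, hu₀, hp₀, hVopen, hVne, hVimg, hfib, hobjC⟩ :=
    hobj 𝒳 S f s₀ e' hfam hemb hirr hsm hSqp habS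
  obtain ⟨C⟩ := hC
  obtain ⟨E₀, hE₀, c, r, hr, hsr, hch⟩ := hobjC C
  have hr' : ((r m : ℚ) : ℂ) ≠ 0 := by exact_mod_cast hr
  -- fibre maps `pu : 𝒬_u → 𝒳_{g(u)}`
  choose pu hpu hpusurj hpund using fun u => (hfib u).2.2.2
  -- the Chern character of `E₀` in the engine's shape
  have hch' : ∀ k : ℕ, C.ch (fiberOver π u₀) E₀ k =
      (∑ i ∈ Finset.range (k + 1), ∑ j ∈ Finset.range (k + 1),
        if hij : i + j = k then
          ((c k i j : ℚ) : ℂ) • cupProduct (show 2 * i + 2 * j = 2 * k by omega)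
            (complexBetti.map (fiberι π u₀) (2 * i) (complexBetti.map pp (2 * i) (cupPowTwo H i)))
            (cupPowTwo (complexBetti.map (fiberι π u₀) 2 Λ) j)
        else 0) +
      (if hk : n ≤ k then
          ((r (k - n) : ℚ) : ℂ) • cupProduct (show 2 * n + 2 * (k - n) = 2 * k by omega)
            (complexBetti.map (fiberι π u₀) (2 * n) (complexBetti.map pp (2 * n) W))
            (cupPowTwo (complexBetti.map (fiberι π u₀) 2 Λ) (k - n))
        else 0) := by
    intro k
    rw [hch k]
    have hHi : ∀ i, complexBetti.map (fiberι π u₀) (2 * i) (complexBetti.map pp (2 * i) (cupPowTwo H i)) =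
        complexBetti.map p₀ (2 * i) (complexBetti.map e'.inv (2 * i) (cupPowTwo h i)) := by
      intro i
      rw [map_map_eq_of_comm_sq hp₀, complexBetti_map_cupPowTwo (fiberι f s₀) H i, hH₀,
        ← complexBetti_map_cupPowTwo]
    have hWW : complexBetti.map (fiberι π u₀) (2 * n) (complexBetti.map pp (2 * n) W) =
        complexBetti.map p₀ (2 * n) (complexBetti.map e'.inv (2 * n) w) := by
      rw [map_map_eq_of_comm_sq hp₀, hW₀]
    simp only [hHi, hWW]
  -- the engine: the charged class is algebraic on EVERY Brauer–Severi fibre `𝒬_u`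
  have hΛ' : ∀ u', IsRationalClass (complexBetti.map (fiberι π u') 2 Λ) ∧
      IsOfHodgeType (2 * n + m) (fiberOver π u') 2 1 1 (complexBetti.map (fiberι π u') 2 Λ) := fun u' =>
    ⟨(hfib u').1, (hfib u').2.1⟩
  have halg := engine_of_perry_BS hP n (2 * n + m) f g π pp hfam hπfam hUirr hUsm hUqp pu hpu H hHfib W hWrat hWH Λ
    hΛ' c r u₀ C.toChernCharacterBetti E₀ hE₀ hsr hch'
  -- Gysin descent on every fibre over the image of `U`: `W|_{𝒳_{g(u)}}` is algebraic
  have hdesc : ∀ u' : ComplexPoints U,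
      complexBetti.map (fiberι f (u' ≫ g)) (2 * n) W ∈ algebraicClasses (fiberOver f (u' ≫ g)) n := by
    intro u'
    -- the abelian fibre `𝒳_{g(u')} ≅ A''`
    obtain ⟨A'', -, hA''dim, -, ⟨eY⟩⟩ := habS (u' ≫ g)
    have hYsp : IsSmoothProjective (2 * n) (fiberOver f (u' ≫ g)) := hfam.isSmoothProjective _
    have hA''sp : IsSmoothProjective (2 * n) A''.X := by
      have h := AbelianVariety.isSmoothProjective_holds (A := A'')
      rw [AbelianVariety.isSmoothProjective, hA''dim] at h
      exact h
    set HY : complexBetti (fiberOver f (u' ≫ g)) 2 := complexBetti.map (fiberι f (u' ≫ g)) 2 H with hHYdef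
    -- `H_Y` is an algebraic divisor class (Lefschetz (1,1) on the abelian `A''`)
    have hHYrat : IsRationalClass (complexBetti.map eY.hom 2 HY) := (hHfib _).1.map _
    have hHYH : IsOfHodgeType (2 * n) A''.X 2 1 1 (complexBetti.map eY.hom 2 HY) := (hHfib _).2.map_of_iso eY
    have hHYalg' : complexBetti.map eY.hom 2 HY ∈ algebraicClasses A''.X 1 :=
      lefschetzOneOne_rational_holds hA''sp _ hHYrat hHYH
    -- cup with `H_Y` preserves algebraicity (Kleiman on the abelian `A''`, transported along `eY`)
    have hcupH : ∀ (l : ℕ) (α : complexBetti (fiberOver f (u' ≫ g)) (2 * l)),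
        α ∈ algebraicClasses (fiberOver f (u' ≫ g)) l →
          cupProduct (two_mul_add_two l) α HY ∈ algebraicClasses (fiberOver f (u' ≫ g)) (l + 1) := by
      intro l α hα
      have hα' : complexBetti.map eY.hom (2 * l) α ∈ algebraicClasses A''.X l := Theorems.isoInvariance_proof eY l _ hα
      have h := AbelianVariety.cupProduct_mem_algebraicClasses_one (A := A'') (l := l) hα' hHYalg'
      refine owf_isoTransport _ A'' eY (l + 1) _ ?_
      rw [complexBetti.map_cupProduct]
      exact h
    have hHpow : ∀ i : ℕ, cupPowTwo HY i ∈ algebraicClasses (fiberOver f (u' ≫ g)) i := by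
      intro i
      cases i with
      | zero => rw [cupPowTwo_zero, algebraicClasses_zero]; exact Submodule.mem_top
      | succ i =>
        refine owf_isoTransport _ A'' eY (i + 1) _ ?_
        rw [complexBetti_map_cupPowTwo]
        exact cupPowTwo_mem_algebraicClasses_abelian A'' hHYalg' i
    -- the algebraic class on `𝒬_{u'}` in degree `n + m`, in the shape of `hD`
    have halg' := halg u' (n + m)
    have hsplit : (if hk : n ≤ n + m then
        ((r (n + m - n) : ℚ) : ℂ) • cupProduct (show 2 * n + 2 * (n + m - n) = 2 * (n + m) by omega)
          (complexBetti.map (fiberι π u') (2 * n) (complexBetti.map pp (2 * n) W))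
          (cupPowTwo (complexBetti.map (fiberι π u') 2 Λ) (n + m - n))
        else 0) =
        ((r m : ℚ) : ℂ) • cupProduct (show 2 * n + 2 * m = 2 * (n + m) by omega)
          (complexBetti.map (pu u') (2 * n) (complexBetti.map (fiberι f (u' ≫ g)) (2 * n) W))
          (cupPowTwo (complexBetti.map (fiberι π u') 2 Λ) m) := by
      rw [dif_pos (Nat.le_add_right n m), map_map_eq_of_comm_sq (hpu u')]
      have hmn : n + m - n = m := Nat.add_sub_cancel_left n m
      congr 1
      · rw [hmn]
      · exact cupProduct_cupPowTwo_congr _ _ hmn _ _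
    rw [hsplit] at halg'
    have hsum : (∑ i ∈ Finset.range (n + m + 1), ∑ j ∈ Finset.range (n + m + 1),
        if hij : i + j = n + m then
          ((c (n + m) i j : ℚ) : ℂ) • cupProduct (show 2 * i + 2 * j = 2 * (n + m) by omega)
            (complexBetti.map (fiberι π u') (2 * i) (complexBetti.map pp (2 * i) (cupPowTwo H i)))
            (cupPowTwo (complexBetti.map (fiberι π u') 2 Λ) j)
        else 0) =
        ∑ i ∈ Finset.range (n + m + 1), ∑ j ∈ Finset.range (n + m + 1),
        if hij : i + j = n + m then
          ((c (n + m) i j : ℚ) : ℂ) • cupProduct (show 2 * i + 2 * j = 2 * (n + m) by omega)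
            (complexBetti.map (pu u') (2 * i) (cupPowTwo HY i))
            (cupPowTwo (complexBetti.map (fiberι π u') 2 Λ) j)
        else 0 := by
      refine Finset.sum_congr rfl fun i _ => Finset.sum_congr rfl fun j _ => ?_
      split_ifs with hij
      · rw [map_map_eq_of_comm_sq (hpu u'), complexBetti_map_cupPowTwo (fiberι f (u' ≫ g)) H i]
      · rfl
    rw [hsum] at halg'
    exact hD (2 * n) m (hπfam.isSmoothProjective u') hYsp (pu u') (hpusurj u') HY
      (complexBetti.map (fiberι π u') 2 Λ) hcupH hHpow (hfib u').2.2.1 (hpund u') n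
      (complexBetti.map (fiberι f (u' ≫ g)) (2 * n) W) (fun i j => ((c (n + m) i j : ℚ) : ℂ)) (((r m : ℚ) : ℂ))
      hr' halg'
  -- every fibre over `V` is reached from `U`
  have hV : ∀ t : ComplexPoints S, t.pt ∈ V →
      complexBetti.map (fiberι f t) (2 * n) W ∈ algebraicClasses (fiberOver f t) n := by
    intro t ht
    obtain ⟨u', rfl⟩ := hVimg t ht
    exact hdesc u'
  -- SPREAD to all fibres, in particular to the reached `𝒳_{s₁} ≅ A'`
  have hW₁alg : w₁ ∈ algebraicClasses (fiberOver f s₁) n := by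
    rw [← hW₁]
    exact hK f (2 * n) n hfam hemb hirr hsm hSqp W V hVopen hVne hV s₁
  -- a NON-ZERO ALGEBRAIC class of the strong Weil plane of `A'`: one class suffices (unconditional)
  have hw₁alg : complexBetti.map e₁.hom (2 * n) w₁ ∈ algebraicClasses A'.X n :=
    Theorems.isoInvariance_proof e₁ n _ hW₁alg
  have hA'alg : weilClassesOf A' φ' n d ≤ algebraicClasses A'.X n :=
    (weilClassesOf_le_algebraicClasses_iff_exists_ne_zero_of_dim_eq abelianVarietyCohomologyExteriorH1_holds
      hA'dim hn hd hφ'A).mpr ⟨_, hw₁W, hw₁alg, hw₁0⟩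
  -- isogeny transfer `A → A'` (landed)
  have hφℤ : φ ≫ φ = -((d : ℤ) • 𝟙 A) := by rw [hφ, natCast_zsmul]
  exact stub_isogenyTransfer d n A A' φ φ' hA hA'dim hφℤ u v m' hm' huv hu hv hA'alg

/-! ## The crux at `(n, d) = (4, 7)` (BY NAME) -/

/-- **`HyperbolicEightfoldsSqrtMinus7` from ONE anchor object on a Brauer–Severi family** (plus the named facts F, P, the
construction C; spread K and Gysin descent D are the LANDED stubs `stub_spread`, `stub_gysinDescent`, consumed here): the
hypothesis `hO` is, up to unfolding, VERBATIM the registered stub `stub_anchorObjectBS : SecantAnchorObjectBS 4 7` of the line's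
skeleton v4; so this theorem closes the crux from the four remaining registered stubs {O′, F, P, C}.  Given a
hyperbolic `(A, φ, e_A, a_A)` and a rational `(4,4)` class `c` of the typed Weil plane: `c` lies in the strong Weil plane
(`stub_upgrade`, landed), which is algebraic by `weilClasses_algebraic_of_anchorObjectBS`.
[cite: Markman2025SecantWeil, Lemma 7.5.1, §7.5.2 and Thm. 1.5.1] [cite: Deligne1982HodgeCycles, proof of Thm. 4.8]
[cite: Perry2026Semiregularity, Thm. 1.1 (2)] -/
theorem hyperbolicEightfoldsSqrtMinus7_of_anchorObjectBS :
    (∃ (P : AbelianVariety ℂ) (ψ : P ⟶ P) (e : ProjectiveEmbedding P.X)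
      (a : complexBetti (projectiveSpace e.n ℂ) 2) (w : complexBetti P.X (2 * 4)),
      P.dim = 2 * 4 ∧ ψ ≫ ψ = -((7 : ℕ) • 𝟙 P) ∧ IsRationalClass a ∧ a ≠ 0 ∧
      IsHyperbolicWeilType P ψ 4
        (((7 : ℕ) : ℂ) • complexBetti.map e.ι 2 a + complexBetti.map ψ.hom.hom.hom 2 (complexBetti.map e.ι 2 a)) ∧
      w ∈ weilClassesOf P ψ 4 7 ∧ IsRationalClass w ∧ w ≠ 0 ∧
      ∀ (𝒳 S : SchemeOver ℂ) (f : 𝒳 ⟶ S) (s₀ : ComplexPoints S) (e' : P.X ≅ fiberOver f s₀),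
        IsSmoothProjectiveFamily f (2 * 4) →
        (∃ (N : ℕ) (ι : 𝒳 ⟶ MonoidalCategoryStruct.tensorObj (projectiveSpace N ℂ) S),
          IsClosedImmersion ι.left ∧ ι ≫ CartesianMonoidalCategory.snd (projectiveSpace N ℂ) S = f) →
        IrreducibleSpace S.left → AlgebraicGeometry.Smooth S.hom → IsQuasiProjectiveOver S →
        (∀ s : ComplexPoints S, ∃ (A'' : AbelianVariety ℂ) (φ'' : A'' ⟶ A''),
          A''.dim = 2 * 4 ∧ φ'' ≫ φ'' = -((7 : ℕ) • 𝟙 A'') ∧ Nonempty (A''.X ≅ fiberOver f s)) →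
        ∃ (U 𝒬 : SchemeOver ℂ) (g : U ⟶ S) (π : 𝒬 ⟶ U) (p : 𝒬 ⟶ 𝒳) (m : ℕ) (u₀ : ComplexPoints U)
          (p₀ : fiberOver π u₀ ⟶ fiberOver f s₀) (Λ : complexBetti 𝒬 2) (V : Set S.left),
          AlgebraicGeometry.Smooth U.hom ∧ IrreducibleSpace U.left ∧ IsQuasiProjectiveOver U ∧
          IsSmoothProjectiveFamily π (2 * 4 + m) ∧ p ≫ f = π ≫ g ∧ u₀ ≫ g = s₀ ∧
          p₀ ≫ fiberι f s₀ = fiberι π u₀ ≫ p ∧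
          IsOpen V ∧ V.Nonempty ∧ (∀ t : ComplexPoints S, t.pt ∈ V → ∃ u : ComplexPoints U, u ≫ g = t) ∧
          (∀ u : ComplexPoints U,
            IsRationalClass (complexBetti.map (fiberι π u) 2 Λ) ∧
            IsOfHodgeType (2 * 4 + m) (fiberOver π u) 2 1 1 (complexBetti.map (fiberι π u) 2 Λ) ∧
            (∀ j : ℕ, cupPowTwo (complexBetti.map (fiberι π u) 2 Λ) j ∈ algebraicClasses (fiberOver π u) j) ∧
            ∃ pu : fiberOver π u ⟶ fiberOver f (u ≫ g),
              pu ≫ fiberι f (u ≫ g) = fiberι π u ≫ p ∧ Function.Surjective pu.left.base ∧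
              ∃ y : complexBetti (fiberOver f (u ≫ g)) (2 * (2 * 4)),
                cupProduct (show 2 * (2 * 4) + 2 * m = 2 * (2 * 4 + m) by omega)
                  (complexBetti.map pu (2 * (2 * 4)) y) (cupPowTwo (complexBetti.map (fiberι π u) 2 Λ) m) ≠ 0) ∧
          ∀ C : StandardChernCharacterBetti,
            ∃ (E₀ : (fiberOver π u₀).left.Modules) (hE₀ : IsFiniteLocallyFree E₀) (c : ℕ → ℕ → ℕ → ℚ) (r : ℕ → ℚ),
              r m ≠ 0 ∧ IsISemiregular hE₀ Set.univ ∧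
              ∀ k : ℕ, C.ch (fiberOver π u₀) E₀ k =
                (∑ i ∈ Finset.range (k + 1), ∑ j ∈ Finset.range (k + 1),
                  if hij : i + j = k then
                    ((c k i j : ℚ) : ℂ) • cupProduct (show 2 * i + 2 * j = 2 * k by omega)
                      (complexBetti.map p₀ (2 * i) (complexBetti.map e'.inv (2 * i) (cupPowTwo
                        (((7 : ℕ) : ℂ) • complexBetti.map e.ι 2 a +
                          complexBetti.map ψ.hom.hom.hom 2 (complexBetti.map e.ι 2 a)) i)))
                      (cupPowTwo (complexBetti.map (fiberι π u₀) 2 Λ) j)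
                  else 0) +
                (if hk : 4 ≤ k then
                    ((r (k - 4) : ℚ) : ℂ) • cupProduct (show 2 * 4 + 2 * (k - 4) = 2 * k by omega)
                      (complexBetti.map p₀ (2 * 4) (complexBetti.map e'.inv (2 * 4) w))
                      (cupPowTwo (complexBetti.map (fiberι π u₀) 2 Λ) (k - 4))
                  else 0)) →
    weilFamilyReach_hyperbolic → Perry2026_semiregularFull_remainsAlgebraic →
    Nonempty StandardChernCharacterBetti →
    Summit.HodgeConjecture.HodgeConjecture.Theses.HeckePrymWeil.HyperbolicEightfoldsSqrtMinus7 := by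
  intro hO hF hP hC A φ hA hφ eA aA haA haA0 hhypA c _ _ hW
  have hA' : A.dim = 2 * 4 := hA
  have hcW : c ∈ weilClassesOf A φ 4 7 :=
    stub_upgrade 7 (by norm_num) (by norm_num) le_rfl 4 A φ hA' hφ hW
  -- casts: the general theorem is stated with `ℕ`-scalars `(d : ℂ)` and `d • 𝟙`
  have h7 : ((7 : ℕ) : ℂ) = (7 : ℂ) := Nat.cast_ofNat
  have hφ' : φ ≫ φ = -((7 : ℕ) • 𝟙 A) := by rw [hφ, ← natCast_zsmul]; rfl
  have hhypA' : IsHyperbolicWeilType A φ 4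
      (((7 : ℕ) : ℂ) • complexBetti.map eA.ι 2 aA +
        complexBetti.map φ.hom.hom.hom 2 (complexBetti.map eA.ι 2 aA)) := by
    rw [h7]; exact hhypA
  exact weilClasses_algebraic_of_anchorObjectBS 4 7 (by norm_num) (by norm_num) hO hF hP hC stub_spread stub_gysinDescent
    A φ hA' hφ' eA aA haA haA0 hhypA' hcW

end Summit.HodgeConjecture.HodgeConjecture.Theorems.HyperbolicEightfoldsSqrtMinus7.AnchorObjectBS

end
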